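import Summits.HubbardSuperconductivity.HubbardSuperconductivity.Theses.CooperPairDMottWalk
import Literature.MathematicalPhysics.QuantumLattice.PlaquetteBreathingSelectionRules
import Literature.MathematicalPhysics.QuantumLattice.HubbardLiebTwoHoppingsSector

/-!
# Route `CooperPairDMottWalk`, crux `CooperPairDMott` (stmt-HubbardSuperconductivity-1177):
# stub D (`stub_dWaveResidueOfUniquePair`) reduced to ONE good pair of ground states

Stub D of the line `Cruxes/CooperPairDMott/Lines/birth.lean` is clause (c) of the crux GIVEN clause
(b) at the same side `L = 4k + 4`: if the two-hole `(L²-2, S^z = 0)` ground state `φ₂` of the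
breathing torus `H_L(1, b, U)` is unique up to a scalar, then for EVERY half-filled `(L², 0)` ground
state `φ₀` the `d`-wave pair amplitude is macroscopic, `z L² ‖φ₀‖² ‖φ₂‖² ≤ |⟨φ₂, Δ_d φ₀⟩|²`.
The mathematics landed for it lives in Literature (all proved):

* `HubbardLiebTwoHoppings{,Core,Sector}` — Lieb's Theorem 2 for the Hubbard Hamiltonian with two
  hopping constants; `breathing_parent_groundStates_smul`: the `((4k+4)², 0)` ground state of
  `Hb (4k+4) 1 b U` is unique up to a scalar for every `b ≠ 0`, `U > 0` (the parent is ONE ray);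
* `PlaquetteBreathingSpaceGroup`, `PlaquetteBreathingSelectionRules` — homogeneity of clause (c)
  (`amplitudeBound_forall_of_exists`), the plaquette space group of `H_L(a,b,U)` and the `d`-wave
  selection rules (kill criterion (ii) typed: nonzero pair momentum relative to the parent, or a
  two-hole state not `B₁g` relative to the parent under the plaquette-centred `C₄`, forces
  `⟨φ₂, Δ_d φ₀⟩ = 0`).

This file is the stub-shaped glue: the registered stub, VERBATIM, follows from "parent unique ∧
∃ one good pair" (`dWaveResidueOfUniquePair_of_parentUnique_of_exists`) and hence, by Lieb, from
"∃ one good pair" alone (`dWaveResidueOfUniquePair_of_exists`). What remains open is exactly the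
`L`-uniform structure of the two dressed ground states (zero-momentum `B₁g` bottom of the pair band
and the plaquette matrix element `m_d(U) ≠ 0`, clause 4 of `PlaquettePairBinding`): no engine for
the convergent expansion / quasi-locality of the dressed states is in the tree.

Sources: E. H. Lieb, PRL 62 (1989) 1201, Theorem 2; D. J. Scalapino, Phys. Rep. 250 (1995) §2.
No definition, no named fact.
-/

set_option linter.dupNamespace false

noncomputable section

namespace Summit.HubbardSuperconductivity.HubbardSuperconductivity.Theorems.CooperPairDMottWalk

open Matrix Finset
open Literature.Hubbard Literature.MathematicalPhysics.QuantumLattice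
open Literature.Probability.LatticeModels
open scoped ComplexOrder
open Summit.HubbardSuperconductivity.HubbardSuperconductivity.Theses.CooperPairDMottWalk

/-- **Stub D reduced.** The registered stub `stub_dWaveResidueOfUniquePair` (clause (c) of
`CooperPairDMott` GIVEN clause (b), for ALL pairs of sector ground states) follows from the same
statement with the conclusion replaced by: the half-filled `(L², 0)` ground state of
`H_L(1, b, U)` is unique up to scalars (Lieb's second theorem on the connected bipartite breathing
torus, `b ≠ 0`, `U > 0`) AND there is ONE pair (`φ₀` parent ground state, `φ₂` two-hole ground
state) with `z L² ‖φ₀‖² ‖φ₂‖² ≤ |⟨φ₂, Δ_d φ₀⟩|²` — by homogeneity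
(`amplitudeBound_forall_of_exists`). [folklore] -/
theorem dWaveResidueOfUniquePair_of_parentUnique_of_exists
    (h : (let Hb := fun (L : ℕ) (a b U : ℝ) => hamiltonian (fermionTorusGraph 2 L \ (⊤ : SimpleGraph (Fin 2 → ℕ)).comap (fun (x : FermionTorus 2 L) (i : Fin 2) => (ofLex x i : ℕ) / 2)) a U + hamiltonian (fermionTorusGraph 2 L ⊓ (⊤ : SimpleGraph (Fin 2 → ℕ)).comap (fun (x : FermionTorus 2 L) (i : Fin 2) => (ofLex x i : ℕ) / 2)) b 0;
    ∀ U ∈ Set.Icc (2 : ℝ) 4, ∃ b₀ > (0 : ℝ), ∀ b ∈ Set.Ioo 0 b₀, ∃ z > (0 : ℝ), ∃ k₀ : ℕ, ∀ k ≥ k₀,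
      (∀ φ₁ φ₂, IsGroundStateInSector (Hb (4 * k + 4) 1 b U) ((4 * k + 4) ^ 2 - 2) 0 φ₁ →
        IsGroundStateInSector (Hb (4 * k + 4) 1 b U) ((4 * k + 4) ^ 2 - 2) 0 φ₂ → ∃ c : ℂ, φ₂ = c • φ₁) →
      (∀ φ₁ φ₂, IsGroundStateInSector (Hb (4 * k + 4) 1 b U) ((4 * k + 4) ^ 2) 0 φ₁ →
        IsGroundStateInSector (Hb (4 * k + 4) 1 b U) ((4 * k + 4) ^ 2) 0 φ₂ → ∃ c : ℂ, φ₂ = c • φ₁) ∧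
      ∃ φ₀ φ₂, IsGroundStateInSector (Hb (4 * k + 4) 1 b U) ((4 * k + 4) ^ 2) 0 φ₀ ∧
        IsGroundStateInSector (Hb (4 * k + 4) 1 b U) ((4 * k + 4) ^ 2 - 2) 0 φ₂ ∧
          z * ((4 * k + 4 : ℕ) : ℝ) ^ 2 * (star φ₀ ⬝ᵥ φ₀).re * (star φ₂ ⬝ᵥ φ₂).re ≤
            ‖star φ₂ ⬝ᵥ (pairField dWaveFormFactor (4 * k + 4) *ᵥ φ₀)‖ ^ 2)) :
    (let Hb := fun (L : ℕ) (a b U : ℝ) => hamiltonian (fermionTorusGraph 2 L \ (⊤ : SimpleGraph (Fin 2 → ℕ)).comap (fun (x : FermionTorus 2 L) (i : Fin 2) => (ofLex x i : ℕ) / 2)) a U + hamiltonian (fermionTorusGraph 2 L ⊓ (⊤ : SimpleGraph (Fin 2 → ℕ)).comap (fun (x : FermionTorus 2 L) (i : Fin 2) => (ofLex x i : ℕ) / 2)) b 0;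
    ∀ U ∈ Set.Icc (2 : ℝ) 4, ∃ b₀ > (0 : ℝ), ∀ b ∈ Set.Ioo 0 b₀, ∃ z > (0 : ℝ), ∃ k₀ : ℕ, ∀ k ≥ k₀,
      (∀ φ₁ φ₂, IsGroundStateInSector (Hb (4 * k + 4) 1 b U) ((4 * k + 4) ^ 2 - 2) 0 φ₁ →
        IsGroundStateInSector (Hb (4 * k + 4) 1 b U) ((4 * k + 4) ^ 2 - 2) 0 φ₂ → ∃ c : ℂ, φ₂ = c • φ₁) →
      ∀ φ₀ φ₂, IsGroundStateInSector (Hb (4 * k + 4) 1 b U) ((4 * k + 4) ^ 2) 0 φ₀ →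
        IsGroundStateInSector (Hb (4 * k + 4) 1 b U) ((4 * k + 4) ^ 2 - 2) 0 φ₂ →
          z * ((4 * k + 4 : ℕ) : ℝ) ^ 2 * (star φ₀ ⬝ᵥ φ₀).re * (star φ₂ ⬝ᵥ φ₂).re ≤
            ‖star φ₂ ⬝ᵥ (pairField dWaveFormFactor (4 * k + 4) *ᵥ φ₀)‖ ^ 2) := by
  dsimp only at h ⊢
  intro U hU
  obtain ⟨b₀, hb₀, hb⟩ := h U hU
  refine ⟨b₀, hb₀, fun b hbm => ?_⟩
  obtain ⟨z, hz, k₀, hk⟩ := hb b hbm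
  refine ⟨z, hz, k₀, fun k hk' huniq₂ => ?_⟩
  obtain ⟨huniq₀, hex⟩ := hk k hk' huniq₂
  exact amplitudeBound_forall_of_exists _ _ _ _ _ _ _ huniq₀ huniq₂ hex


/-- **Stub D ⟸ one good pair.** The registered stub `stub_dWaveResidueOfUniquePair` (clause (c) of
`CooperPairDMott` GIVEN clause (b), for ALL pairs of sector ground states, verbatim) follows from:
for every `U ∈ [2,4]` and small `b > 0` there are `z > 0`, `k₀` such that for `k ≥ k₀`, IF the
two-hole ground state is unique, THEN SOME parent ground state `φ₀` and SOME two-hole ground state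
`φ₂` of `H_{4k+4}(1,b,U)` have `z L² ‖φ₀‖² ‖φ₂‖² ≤ |⟨φ₂, Δ_d φ₀⟩|²`. (The parent is unique by
Lieb's Theorem 2, `breathing_parent_groundStates_smul`, since `b > 0`, `U ≥ 2 > 0`; both sides of
(c) are homogeneous, `dWaveResidueOfUniquePair_of_parentUnique_of_exists`.) [cite: LiebPRL1989, Theorem 2] -/
theorem dWaveResidueOfUniquePair_of_exists : ((let Hb := fun (L : ℕ) (a b U : ℝ) => hamiltonian (fermionTorusGraph 2 L \ (⊤ : SimpleGraph (Fin 2 → ℕ)).comap (fun (x : FermionTorus 2 L) (i : Fin 2) => (ofLex x i : ℕ) / 2)) a U + hamiltonian (fermionTorusGraph 2 L ⊓ (⊤ : SimpleGraph (Fin 2 → ℕ)).comap (fun (x : FermionTorus 2 L) (i : Fin 2) => (ofLex x i : ℕ) / 2)) b 0; ∀ U ∈ Set.Icc (2 : ℝ) 4, ∃ b₀ > (0 : ℝ), ∀ b ∈ Set.Ioo 0 b₀, ∃ z > (0 : ℝ), ∃ k₀ : ℕ, ∀ k ≥ k₀, (∀ φ₁ φ₂, IsGroundStateInSector (Hb (4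 * k + 4) 1 b U) ((4 * k + 4) ^ 2 - 2) 0 φ₁ → IsGroundStateInSector (Hb (4 * k + 4) 1 b U) ((4 * k + 4) ^ 2 - 2) 0 φ₂ → ∃ c : ℂ, φ₂ = c • φ₁) → ∃ φ₀ φ₂, IsGroundStateInSector (Hb (4 * k + 4) 1 b U) ((4 * k + 4) ^ 2) 0 φ₀ ∧ IsGroundStateInSector (Hb (4 * k + 4) 1 b U) ((4 * k + 4) ^ 2 - 2) 0 φ₂ ∧ z * ((4 * k + 4 : ℕ) : ℝ) ^ 2 * (star φ₀ ⬝ᵥ φ₀).re * (star φ₂ ⬝ᵥ φ₂).re ≤ ‖star φ₂ ⬝ᵥ (pairField dWaveFormFactor (4 * k + 4) *ᵥ φ₀)‖ ^ 2)) → (let Hb := fun (L : ℕ) (a b U : ℝ) => hamiltonian (fermionTorusGraph 2 L \ (⊤ : SimpleGraph (Fin 2 → ℕ)).comap (fun (x : FermionTorus 2 L) (i : Fin 2) => (ofLex x i : ℕ) / 2)) a U + hamiltonian (fermionTorusGraph 2 L ⊓ (⊤ : SimpleGraph (Fin 2 → ℕ)).comap (fun (x : FermionTorus 2 L) (i : Fin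 2) => (ofLex x i : ℕ) / 2)) b 0; ∀ U ∈ Set.Icc (2 : ℝ) 4, ∃ b₀ > (0 : ℝ), ∀ b ∈ Set.Ioo 0 b₀, ∃ z > (0 : ℝ), ∃ k₀ : ℕ, ∀ k ≥ k₀, (∀ φ₁ φ₂, IsGroundStateInSector (Hb (4 * k + 4) 1 b U) ((4 * k + 4) ^ 2 - 2) 0 φ₁ → IsGroundStateInSector (Hb (4 * k + 4) 1 b U) ((4 * k + 4) ^ 2 - 2) 0 φ₂ → ∃ c : ℂ, φ₂ = c • φ₁) → ∀ φ₀ φ₂, IsGroundStateInSector (Hb (4 * k + 4) 1 b U) ((4 * k + 4) ^ 2) 0 φ₀ → IsGroundStateInSector (Hb (4 * k + 4) 1 b U) ((4 * k + 4) ^ 2 - 2) 0 φ₂ → z * ((4 * k + 4 : ℕ) : ℝ) ^ 2 * (star φ₀ ⬝ᵥ φ₀).re * (star φ₂ ⬝ᵥ φ₂).re ≤ ‖star φ₂ ⬝ᵥ (pairField dWaveFormFactor (4 * k + 4) *ᵥ φ₀)‖ ^ 2) := by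
  intro h
  refine dWaveResidueOfUniquePair_of_parentUnique_of_exists ?_
  dsimp only at h ⊢
  intro U hU
  obtain ⟨b₀, hb₀, hb⟩ := h U hU
  refine ⟨b₀, hb₀, fun b hbm => ?_⟩
  obtain ⟨z, hz, k₀, hk⟩ := hb b hbm
  refine ⟨z, hz, k₀, fun k hk' huniq₂ => ⟨?_, hk k hk' huniq₂⟩⟩
  have hparent := breathing_parent_groundStates_smul
  dsimp only at hparent
  exact hparent k b U (ne_of_gt hbm.1) (by linarith [hU.1])


end Summit.HubbardSuperconductivity.HubbardSuperconductivity.Theorems.CooperPairDMottWalk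

end
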